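import Literature.Analysis.OperatorTheory.CompactSelfAdjointEigenbasis
import Literature.Analysis.OperatorTheory.HilbertSchmidtOrthogonalSum
import Literature.Analysis.InnerProduct.KyFanOrthonormal
import Mathlib.Analysis.InnerProductSpace.Positive
import Mathlib.Topology.Algebra.Order.Field
import HarnessLib

/-!
# The spectral theorem for a closed form with compactly embedded domain

Topic `Literature/Analysis/OperatorTheory`. The variational ("form") version of *a self-adjoint
operator bounded below with compact resolvent has an orthonormal eigenbasis with eigenvalues
`λ₁ ≤ λ₂ ≤ … → ∞`* (Reed–Simon IV, Thm. XIII.64 (compact resolvent ⟺ …), with Thm. XIII.1–2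
(min–max)), in the setting in which Schrödinger-type Hamiltonians are actually given in the tree —
by their quadratic form on a form domain:

Let `H` be a Hilbert space and `Q` a Hilbert space continuously and injectively embedded in `H` with
dense range by `J : Q →L H` (think `Q = Q(A)` with the form inner product
`⟪x, y⟫_Q = ⟪x, y⟫_H + 𝔞(x, y)`, `𝔞 ≥ 0` closed, so that the form is `q(x) = ‖x‖_Q² - ‖J x‖_H²`), and
assume the embedding `J` is COMPACT (Rellich). Then (`exists_hilbertBasis_form_hasSum`) there are a
Hilbert basis `(f_i)` of `H` made of images `f_i = J e_i` of form-eigenvectors `e_i ∈ Q`, and levels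
`λ_i` with `λ_i → +∞` along the cofinite filter, such that for every `x ∈ Q`

  `q(x) = ‖x‖_Q² - ‖J x‖_H² = Σ_i λ_i |⟪f_i, J x⟫_H|²`      (unconditional sum),

together with the weak eigenvalue equation `⟪e_i, y⟫_Q = (λ_i + 1) ⟪J e_i, J y⟫_H` (`y ∈ Q`), i.e.
`𝔞(e_i, y) = λ_i ⟪e_i, y⟫_H`. This is exactly the input format of the Ky Fan bounds of
`Literature/Analysis/InnerProduct/KyFanOrthonormal.lean` (`kyFan_two_le_hilbertBasis`): the two lowest
levels bound `q(x₁) + q(x₂)` over orthonormal pairs of `Q`, and by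
`…/KyFanPairCoreApproximation.lean` over any form core.

Proof (Reed–Simon IV, proof of XIII.64 run on the form side; Kato VI §2.1): `K = J†J : Q → Q` is
compact, positive and injective; `CompactSelfAdjointEigenbasis.lean` gives a Hilbert basis `(b_i)` of
`Q` with `K b_i = κ_i b_i`, `κ_i = ‖J b_i‖² > 0`; the `J b_i` are `H`-orthogonal
(`⟪J b_i, J b_j⟫ = ⟪K b_i, b_j⟫_Q`), so `f_i = κ_i^{-1/2} J b_i` is orthonormal in `H`, and complete because
`z ⊥ f_i ∀ i ⟹ J†z = 0 ⟹ z ⊥ range J`; finally `|⟪f_i, J x⟫|² = κ_i |⟪b_i, x⟫_Q|²`, so Parseval in `Q` and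
in `H` give the expansion with `λ_i = κ_i⁻¹ - 1`, and `κ_i → 0` (compactness: eigenvalues of a compact
operator along an orthonormal family of eigenvectors tend to `0`, `tendsto_norm_eigenvalue_cofinite`).

* `exists_two_lowest_of_tendsto_atTop`, `form_kyFan_two_le` — the two lowest levels exist, and their
  sum bounds `q(x₁) + q(x₂)` from below for `J x₁ ⊥ J x₂` unit vectors (Ky Fan).

No definitions, no named facts. (Rellich's compactness for concrete domains is not treated here.)

## References

* M. Reed, B. Simon, *Methods of Modern Mathematical Physics IV* (1978), Thm. XIII.64 and §XIII.1.
  [ReedSimonIV1978]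
* T. Kato, *Perturbation Theory for Linear Operators*, VI §2.1 (forms and the associated operators).
* M. Reed, B. Simon, *Methods of Modern Mathematical Physics I* (1980), Thm. VI.16. [ReedSimonI1980]
-/

noncomputable section

open scoped InnerProductSpace ComplexConjugate
open Filter Topology Submodule

namespace Literature.Analysis.OperatorTheory

variable {𝕜 : Type*} [RCLike 𝕜]
variable {Q : Type*} [NormedAddCommGroup Q] [InnerProductSpace 𝕜 Q]
variable {H : Type*} [NormedAddCommGroup H] [InnerProductSpace 𝕜 H]

/-! ### Eigenvalues of a compact operator along an orthonormal family tend to zero -/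

/-- **Eigenvalues of a compact operator along an orthonormal family of eigenvectors tend to `0`**
(F. Riesz): if `T` is compact and `T e_i = μ_i e_i` for an orthonormal family `(e_i)`, then
`μ_i → 0` along the cofinite filter — for `ε > 0` only finitely many `i` have `|μ_i| ≥ ε`, since
`‖T e_i - T e_j‖² = |μ_i|² + |μ_j|² ≥ 2ε²` for such `i ≠ j` while the `T e_i` lie in a compact set
(Reed–Simon I, Thm. VI.15–16). [cite: ReedSimonI1980, Thm. VI.16] -/
theorem tendsto_norm_eigenvalue_cofinite {T : Q →L[𝕜] Q} (hT : IsCompactOperator T)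
    {ι : Type*} {e : ι → Q} (he : Orthonormal 𝕜 e) {μ : ι → 𝕜} (heig : ∀ i, T (e i) = μ i • e i) :
    Tendsto (fun i => ‖μ i‖) cofinite (𝓝 0) := by
  rw [Metric.tendsto_nhds]
  intro ε hε
  simp only [dist_zero_right, norm_norm, eventually_cofinite, not_lt]
  -- the set `S = {i | ε ≤ |μ i|}` is finite: its `T e_i` are `ε`-separated inside a compact set
  by_contra hinf
  have hdist : ∀ i j : {i | ε ≤ ‖μ i‖}, i ≠ j → ε ≤ ‖T (e i) - T (e j)‖ := by
    intro i j hij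
    have hij' : (i : ι) ≠ j := fun h => hij (Subtype.ext h)
    rw [heig, heig]
    have hsq : ‖μ i • e i - μ j • e j‖ ^ 2 = ‖μ i‖ ^ 2 + ‖μ j‖ ^ 2 := by
      rw [@norm_sub_sq 𝕜, inner_smul_left, inner_smul_right, he.2 hij', norm_smul, norm_smul,
        he.1, he.1]
      simp
    have h1 : ε ^ 2 ≤ ‖μ i • e i - μ j • e j‖ ^ 2 := by
      rw [hsq]
      nlinarith [i.2.out, j.2.out, norm_nonneg (μ i), norm_nonneg (μ j)]
    exact (pow_le_pow_iff_left₀ hε.le (norm_nonneg _) two_ne_zero).mp h1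
  haveI : Infinite {i | ε ≤ ‖μ i‖} := Set.infinite_coe_iff.2 hinf
  set φ : ℕ ↪ {i | ε ≤ ‖μ i‖} := Infinite.natEmbedding _
  set x : ℕ → Q := fun n => T (e (φ n))
  have hK : IsCompact (closure ((T : Q →ₗ[𝕜] Q) '' Metric.closedBall 0 1)) :=
    hT.isCompact_closure_image_closedBall 1
  have hxK : ∀ n, x n ∈ closure ((T : Q →ₗ[𝕜] Q) '' Metric.closedBall 0 1) := fun n =>
    subset_closure ⟨e (φ n), by simp [Metric.mem_closedBall, he.1], rfl⟩
  obtain ⟨a, -, ψ, hψ, hlim⟩ := hK.tendsto_subseq hxK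
  obtain ⟨N, hN⟩ := (Metric.tendsto_atTop.mp hlim) (ε / 3) (by positivity)
  have h1 := hN N le_rfl
  have h2 := hN (N + 1) (Nat.le_succ N)
  have hne : φ (ψ N) ≠ φ (ψ (N + 1)) := fun h => (hψ (Nat.lt_succ_self N)).ne (φ.injective h)
  have hd := hdist _ _ hne
  have hlt : dist (x (ψ N)) (x (ψ (N + 1))) < ε := by
    calc dist (x (ψ N)) (x (ψ (N + 1)))
        ≤ dist (x (ψ N)) a + dist a (x (ψ (N + 1))) := dist_triangle _ _ _
      _ < ε / 3 + ε / 3 := add_lt_add h1 (by rw [dist_comm]; exact h2)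
      _ < ε := by linarith
  rw [dist_eq_norm] at hlt
  exact absurd (hd.trans_lt hlt) (lt_irrefl _)

/-! ### The form spectral theorem -/

variable [CompleteSpace Q] [CompleteSpace H]

/-- **Spectral theorem for a closed form with compactly embedded domain (variational form of
"compact resolvent ⟹ discrete spectrum with an orthonormal eigenbasis").** Let `J : Q →L H` be a
compact, injective bounded map with dense range between Hilbert spaces (the embedding of a form
domain, with its form inner product, into the ambient space). Then there exist a set `s ⊆ Q`
(indices), vectors `e : s → Q`, a Hilbert basis `f` of `H` with `f i = J (e i)`, and levels
`lam : s → ℝ` with `-1 < lam i`, `lam → +∞` cofinitely, such that for every `x ∈ Q` the form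
`‖x‖_Q² - ‖J x‖_H²` is the unconditional sum `Σ_i lam i |⟪f i, J x⟫|²`, and each `e i` solves the weak
eigenvalue equation `⟪e i, y⟫_Q = (lam i + 1) ⟪J (e i), J y⟫_H` for all `y ∈ Q`
(Reed–Simon IV, Thm. XIII.64 with §XIII.1; Kato VI §2.1). [cite: ReedSimonIV1978, Thm. XIII.64] -/
theorem exists_hilbertBasis_form_hasSum (J : Q →L[𝕜] H) (hJc : IsCompactOperator J)
    (hJi : Function.Injective J) (hJd : DenseRange J) :
    ∃ (s : Set Q) (e : s → Q) (f : HilbertBasis s 𝕜 H) (lam : s → ℝ),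
      (∀ i, f i = J (e i)) ∧ (∀ i, -1 < lam i) ∧ Tendsto lam cofinite atTop ∧
      (∀ x : Q, HasSum (fun i => lam i * ‖⟪f i, J x⟫_𝕜‖ ^ 2) (‖x‖ ^ 2 - ‖J x‖ ^ 2)) ∧
      (∀ i, ∀ y : Q, ⟪e i, y⟫_𝕜 = (((lam i + 1 : ℝ) : 𝕜)) * ⟪J (e i), J y⟫_𝕜) := by
  -- `K = J†J` is compact, positive (hence symmetric) and injective
  set K : Q →L[𝕜] Q := (ContinuousLinearMap.adjoint J).comp J with hK
  have hKc : IsCompactOperator K := hJc.clm_comp (ContinuousLinearMap.adjoint J)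
  have hKpos : K.IsPositive := ContinuousLinearMap.isPositive_adjoint_comp_self J
  have hKsym : (K : Q →ₗ[𝕜] Q).IsSymmetric := hKpos.isSelfAdjoint.isSymmetric
  have hKinner : ∀ x y : Q, ⟪K x, y⟫_𝕜 = ⟪J x, J y⟫_𝕜 := fun x y => by
    simp only [hK, ContinuousLinearMap.coe_comp, Function.comp_apply,
      ContinuousLinearMap.adjoint_inner_left]
  -- Hilbert basis of `Q` of eigenvectors of `K`
  obtain ⟨s, b, κ, hb, hKb⟩ := exists_hilbertBasis_eigenvectors hKc hKsym
  -- `κ i = ‖J (b i)‖² > 0`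
  have hκ : ∀ i, (κ i : ℝ) = ‖J (b i)‖ ^ 2 := fun i => by
    have h := hKinner (b i) (b i)
    rw [hKb i, inner_smul_left, inner_self_eq_norm_sq_to_K, b.orthonormal.1 i,
      inner_self_eq_norm_sq_to_K, RCLike.conj_ofReal] at h
    have h' := congrArg RCLike.re h
    simpa using h'
  have hκpos : ∀ i, 0 < κ i := fun i => by
    rw [hκ i]
    have : J (b i) ≠ 0 := fun h0 => b.orthonormal.ne_zero i (hJi (by rw [h0, map_zero]))
    positivity
  -- the `J b i` are orthogonal in `H`: `⟪J b i, J b j⟫ = κ i ⟪b i, b j⟫`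
  have hJb : ∀ i j, ⟪J (b i), J (b j)⟫_𝕜 = ((κ i : ℝ) : 𝕜) * ⟪b i, b j⟫_𝕜 := fun i j => by
    rw [← hKinner, hKb i, inner_smul_left, RCLike.conj_ofReal]
  -- normalised images `f i = c i • J (b i)`, `c i = κ i ^ {-1/2}`
  set c : s → ℝ := fun i => (Real.sqrt (κ i))⁻¹ with hc
  have hc2 : ∀ i, c i ^ 2 * κ i = 1 := fun i => by
    simp only [hc, inv_pow, Real.sq_sqrt (hκpos i).le]
    exact inv_mul_cancel₀ (hκpos i).ne'
  have hcpos : ∀ i, 0 < c i := fun i => by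
    simp only [hc]
    exact inv_pos.2 (Real.sqrt_pos.2 (hκpos i))
  set e : s → Q := fun i => ((c i : ℝ) : 𝕜) • b i with he
  set fv : s → H := fun i => J (e i) with hfv
  have hfv' : ∀ i, fv i = ((c i : ℝ) : 𝕜) • J (b i) := fun i => by
    simp only [hfv, he, map_smul]
  -- orthonormality of `fv` in `H`
  have hon : Orthonormal 𝕜 fv := by
    classical
    rw [orthonormal_iff_ite]
    intro i j
    rw [hfv' i, hfv' j, inner_smul_left, inner_smul_right, hJb i j, RCLike.conj_ofReal]
    by_cases hij : i = j
    · subst hij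
      rw [if_pos rfl, inner_self_eq_norm_sq_to_K, b.orthonormal.1 i]
      push_cast
      have := hc2 i
      have h' : (c i : 𝕜) * ((c i : 𝕜) * ((κ i : 𝕜) * 1 ^ 2)) = ((c i ^ 2 * κ i : ℝ) : 𝕜) := by
        push_cast; ring
      rw [h', this]; simp
    · rw [if_neg hij, b.orthonormal.2 hij]
      simp
  -- completeness in `H`: `z ⊥ fv i ∀ i ⟹ J† z = 0 ⟹ z ⊥ range J ⟹ z = 0`
  have hbot : (span 𝕜 (Set.range fv))ᗮ = ⊥ := by
    rw [Submodule.eq_bot_iff]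
    intro z hz
    have hz1 : ∀ i, ⟪J (b i), z⟫_𝕜 = 0 := fun i => by
      have h := (Submodule.mem_orthogonal _ _).1 hz (fv i) (Submodule.subset_span ⟨i, rfl⟩)
      rw [hfv' i, inner_smul_left, RCLike.conj_ofReal, mul_eq_zero] at h
      rcases h with h | h
      · exact absurd (by exact_mod_cast h : c i = 0) (hcpos i).ne'
      · exact h
    have hz2 : ContinuousLinearMap.adjoint J z = 0 := by
      apply b.repr.injective
      rw [map_zero]
      ext i
      rw [b.repr_apply_apply, ← ContinuousLinearMap.adjoint_inner_left]
      simpa [ContinuousLinearMap.adjoint_adjoint] using hz1 i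
    refine hJd.eq_zero_of_inner_right 𝕜 fun y => ?_
    rw [← ContinuousLinearMap.adjoint_inner_right, hz2, inner_zero_right]
  set f : HilbertBasis s 𝕜 H := HilbertBasis.mkOfOrthogonalEqBot hon hbot with hf
  have hfco : ∀ i, f i = fv i := fun i => by
    rw [hf, HilbertBasis.coe_mkOfOrthogonalEqBot]
  -- coefficients: `⟪f i, J x⟫ = c i κ i ⟪b i, x⟫_Q`, so `|⟪f i, J x⟫|² = κ i |⟪b i, x⟫_Q|²`
  have hcoef : ∀ i (x : Q), ‖⟪f i, J x⟫_𝕜‖ ^ 2 = κ i * ‖⟪b i, x⟫_𝕜‖ ^ 2 := fun i x => by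
    rw [hfco i, hfv' i, inner_smul_left, ← hKinner, hKb i, inner_smul_left, RCLike.conj_ofReal,
      RCLike.conj_ofReal, norm_mul, norm_mul, RCLike.norm_ofReal, RCLike.norm_ofReal,
      abs_of_pos (hcpos i), abs_of_pos (hκpos i)]
    have := hc2 i
    nlinarith [sq_nonneg (‖⟪b i, x⟫_𝕜‖), this]
  -- levels
  set lam : s → ℝ := fun i => (κ i)⁻¹ - 1 with hlam
  refine ⟨s, e, f, lam, fun i => hfco i, fun i => ?_, ?_, fun x => ?_, fun i y => ?_⟩
  · -- `-1 < lam i`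
    simp only [hlam]
    have := inv_pos.2 (hκpos i)
    linarith
  · -- `lam → +∞`: `κ → 0⁺` along `cofinite` (compactness), hence `κ⁻¹ → +∞`
    have hκ0 : Tendsto (fun i => κ i) cofinite (𝓝 0) := by
      have h := tendsto_norm_eigenvalue_cofinite hKc b.orthonormal (μ := fun i => ((κ i : ℝ) : 𝕜))
        (fun i => hKb i)
      refine (tendsto_congr fun i => ?_).1 h
      rw [RCLike.norm_ofReal, abs_of_pos (hκpos i)]
    have hκ0' : Tendsto (fun i => κ i) cofinite (𝓝[>] 0) :=
      tendsto_nhdsWithin_iff.2 ⟨hκ0, Eventually.of_forall fun i => hκpos i⟩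
    have hinv : Tendsto (fun i => (κ i)⁻¹) cofinite atTop := tendsto_inv_nhdsGT_zero.comp hκ0'
    simp only [hlam]
    exact tendsto_atTop_add_const_right _ (-1) hinv
  · -- the expansion of the form: Parseval in `Q` (weights `κ⁻¹`) minus Parseval in `H`
    have hQ : HasSum (fun i => (κ i)⁻¹ * ‖⟪f i, J x⟫_𝕜‖ ^ 2) (‖x‖ ^ 2) := by
      refine (hasSum_norm_inner_sq b x).congr_fun fun i => ?_  -- rewrite termwise
      rw [hcoef i x, ← mul_assoc, inv_mul_cancel₀ (hκpos i).ne', one_mul]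
    have hH : HasSum (fun i => ‖⟪f i, J x⟫_𝕜‖ ^ 2) (‖J x‖ ^ 2) := hasSum_norm_inner_sq f (J x)
    refine (hQ.sub hH).congr_fun fun i => ?_
    simp only [hlam]
    ring
  · -- the weak eigenvalue equation `⟪e i, y⟫_Q = (lam i + 1) ⟪J e i, J y⟫ = κ⁻¹ ⟪K e i, y⟫`
    have lhs : ⟪e i, y⟫_𝕜 = ((c i : ℝ) : 𝕜) * ⟪b i, y⟫_𝕜 := by
      simp only [he, inner_smul_left, RCLike.conj_ofReal]
    have rhs : ⟪J (e i), J y⟫_𝕜 = ((c i * κ i : ℝ) : 𝕜) * ⟪b i, y⟫_𝕜 := by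
      rw [← hKinner]
      simp only [he, map_smul, hKb i, smul_smul, inner_smul_left, map_mul, RCLike.conj_ofReal]
    have hlam1 : (lam i + 1) * (c i * κ i) = c i := by
      simp only [hlam, sub_add_cancel]
      rw [mul_comm (c i), ← mul_assoc, inv_mul_cancel₀ (hκpos i).ne', one_mul]
    rw [lhs, rhs, ← mul_assoc, ← RCLike.ofReal_mul, hlam1]

/-! ### The two lowest levels and Ky Fan's bound for the form -/

omit [CompleteSpace Q] [CompleteSpace H] in
/-- Levels tending to `+∞` along the cofinite filter attain a lowest value `lam i₀` and, on the
remaining indices, a second lowest value `lam i₁` (`i₁ ≠ i₀`), as soon as there are two indices.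
[folklore] -/
theorem exists_two_lowest_of_tendsto_atTop {ι : Type*} {lam : ι → ℝ}
    (hlam : Tendsto lam cofinite atTop) {j j' : ι} (hjj : j ≠ j') :
    ∃ i₀ i₁ : ι, i₀ ≠ i₁ ∧ lam i₀ ≤ lam i₁ ∧ (∀ i, lam i₀ ≤ lam i) ∧
      ∀ i, i ≠ i₀ → lam i₁ ≤ lam i := by
  haveI : Nonempty ι := ⟨j⟩
  obtain ⟨i₀, hi₀⟩ := hlam.exists_forall_le
  -- restrict to the complement of `i₀`
  haveI : Nonempty {i // i ≠ i₀} := by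
    by_cases h : j = i₀
    · exact ⟨⟨j', fun h' => hjj (h.trans h'.symm)⟩⟩
    · exact ⟨⟨j, h⟩⟩
  have hres : Tendsto (fun i : {i // i ≠ i₀} => lam i) cofinite atTop :=
    hlam.comp Subtype.val_injective.tendsto_cofinite
  obtain ⟨i₁, hi₁⟩ := hres.exists_forall_le
  exact ⟨i₀, i₁, fun h => i₁.2 h.symm, hi₀ i₁, hi₀, fun i hi => hi₁ ⟨i, hi⟩⟩

omit [CompleteSpace Q] [CompleteSpace H] in
/-- **Ky Fan's bound for a form diagonalised in a Hilbert basis of the ambient space.** If the form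
`q(x) = ‖x‖_Q² - ‖J x‖_H²` expands as `Σ_i lam i |⟪f i, J x⟫|²` along a Hilbert basis `f` of `H` (the
output of `exists_hilbertBasis_form_hasSum`) and `lam i₀ ≤ m₂ ≤ lam i` for `i ≠ i₀`, then for all
`x₁, x₂ ∈ Q` whose images `J x₁, J x₂` are orthonormal in `H`,
`lam i₀ + m₂ ≤ q(x₁) + q(x₂)` — the sum of the two lowest levels bounds the form on orthonormal pairs
(min–max, Reed–Simon IV, Thm. XIII.1–2; `Literature.Analysis.InnerProduct.kyFan_two_le_hilbertBasis`).
[cite: ReedSimonIV1978, §XIII.1 Theorem XIII.2] -/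
theorem form_kyFan_two_le {ι : Type*} (f : HilbertBasis ι 𝕜 H) (J : Q →L[𝕜] H) {lam : ι → ℝ}
    (hsum : ∀ x : Q, HasSum (fun i => lam i * ‖⟪f i, J x⟫_𝕜‖ ^ 2) (‖x‖ ^ 2 - ‖J x‖ ^ 2))
    {i₀ : ι} {m₂ : ℝ} (h₀ : lam i₀ ≤ m₂) (hm : ∀ i, i ≠ i₀ → m₂ ≤ lam i)
    {x₁ x₂ : Q} (h₁ : ‖J x₁‖ = 1) (h₂ : ‖J x₂‖ = 1) (h₁₂ : ⟪J x₁, J x₂⟫_𝕜 = 0) :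
    lam i₀ + m₂ ≤ (‖x₁‖ ^ 2 - ‖J x₁‖ ^ 2) + (‖x₂‖ ^ 2 - ‖J x₂‖ ^ 2) :=
  Literature.Analysis.InnerProduct.kyFan_two_le_hilbertBasis f h₀ hm h₁ h₂ h₁₂ (hsum x₁) (hsum x₂)

end Literature.Analysis.OperatorTheory

end
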